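import Summits.NavierStokesRegularity.FluidComputer.PalasekTowerViscosity

/-!
# A realised tower IS a forced Clay blow-up (the rate-free crux `ForcedClayBlowup` of STEP 1′)

Cell `ns-blowup`; typist `ns-blowup-lean` (g2); planner `ns-blowup-plan` (g16) STEP 1′ (STATUS l.1176,
route-draft-v3): the conditional-bridge route's single load-bearing crux is typed over Literature
vocabulary as

`ForcedClayBlowup := ∀ ν > 0, ∃ T u p f r, 0 < T ∧ IsClassicalNSSolutionOn (Ico 0 T) ν f u p ∧
  HasRapidSpatialDecay (u 0) ∧ IsSmoothOnHalfSpace f ∧ HasRapidSpaceTimeDecay f ∧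
  (∀ T' < T, finite energy on [0, T']) ∧ (∀ M, ∃ t ∈ Ico 0 T, ∃ x, ‖x‖ ≤ r ∧ M < ‖u t x‖)`.

LABEL: E–C typing (KERNEL glue). WHAT THIS IS NOT: not Navier–Stokes evidence — this file PROVES
that the typed interface `Realisation ν R` (p403760) delivers exactly that body
(`Realisation.forcedClayBlowup_data`: the velocity is unbounded on the tower's ball because the
floors `c₁ Y_k → ∞` are attained at points of `B̄(0, radius)` at the readout times `τ_k ∈ [0, T)`),
hence `PalasekStep2 R`, or a single realisation at one viscosity (`Realisation.rescale`), gives the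
crux's body at every `ν > 0` (`forcedClayBlowup_of_palasekStep2`, `forcedClayBlowup_of_realisation`).
The Theorems-side twin then closes the route item `ForcedClayBlowup` from the register's
`EpisodeBaseR → EpisodeInductionR` (`nonempty_realisation_of_episodesR`, p407242) by `exact`.
Nothing is inhabited here.

References: S. Palasek, arXiv:2605.13827 §4 [cite: Palasek2026ElementaryModel, §4]; C. L. Fefferman,
Clay problem description, (C) (4)–(7) [cite: FeffermanClay2006, (C)].
-/

noncomputable section

namespace Summit.NavierStokesRegularity.FluidComputer.PalasekTowerClayBridge

open Set MeasureTheory Filter Topology Function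
open scoped ENNReal ContDiff NNReal
open Literature.Analysis.FluidPDE

namespace Realisation

variable {ν : ℝ} {R : TowerRates} (W : Realisation ν R)

/-- **The velocity of a realisation is unbounded on the tower's ball before `T`**: for every `M`
some readout `(τ_k, x_k)`, `‖x_k‖ ≤ radius`, `τ_k ∈ [0, T)`, has speed `> M` (floors
`c₁ Y_k ≤ ‖u(τ_k, x_k)‖` with `Y_k → ∞`). [folklore] -/
theorem unbounded_on_ball (M : ℝ) :
    ∃ t ∈ Ico 0 W.T, ∃ x : EuclideanSpace ℝ (Fin 3), ‖x‖ ≤ W.radius ∧ M < ‖W.u t x‖ := by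
  have hc₁ : 0 < W.c₁ := W.c₁_pos
  have hev : ∀ᶠ k in atTop, M / W.c₁ + 1 ≤ R.Y k :=
    R.tendsto_Y_atTop.eventually (eventually_ge_atTop (M / W.c₁ + 1))
  obtain ⟨k, hk⟩ := hev.exists
  obtain ⟨x, hxR, hfloor⟩ := W.floor k
  refine ⟨W.τ k, W.τ_mem k, x, hxR, ?_⟩
  have h3 : M / W.c₁ < R.Y k := by linarith
  have h4 : M < R.Y k * W.c₁ := (div_lt_iff₀ hc₁).1 h3
  have h5 : M < W.c₁ * R.Y k := by rwa [mul_comm] at h4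
  exact lt_of_lt_of_le h5 hfloor

/-- **A realisation delivers the body of `ForcedClayBlowup` at its viscosity**: blow-up time,
classical forced solution on `[0, T)`, Clay datum (4), Clay force smooth through `T` with decay (5),
finite energy on every closed slab, and velocity unbounded on `[0, T) × B̄(0, radius)`.
[cite: FeffermanClay2006, (C)] -/
theorem forcedClayBlowup_data (W : Realisation ν R) :
    ∃ (T : ℝ) (u : ℝ → EuclideanSpace ℝ (Fin 3) → EuclideanSpace ℝ (Fin 3))
      (p : ℝ → EuclideanSpace ℝ (Fin 3) → ℝ)
      (f : ℝ → EuclideanSpace ℝ (Fin 3) → EuclideanSpace ℝ (Fin 3)) (r : ℝ),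
      0 < T ∧ IsClassicalNSSolutionOn (Set.Ico 0 T) ν f u p ∧ HasRapidSpatialDecay (u 0) ∧
        IsSmoothOnHalfSpace f ∧ HasRapidSpaceTimeDecay f ∧
        (∀ T' < T, ∃ C : ℝ≥0∞, C < ⊤ ∧ ∀ t ∈ Set.Icc 0 T', ∫⁻ x, ‖u t x‖ₑ ^ 2 ≤ C) ∧
        (∀ M : ℝ, ∃ t ∈ Set.Ico 0 T, ∃ x : EuclideanSpace ℝ (Fin 3), ‖x‖ ≤ r ∧ M < ‖u t x‖) :=
  ⟨W.T, W.u, W.p, W.f, W.radius, W.T_pos, W.classical, W.datum_decay, W.force_smooth,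
    W.force_decay, W.energy, W.unbounded_on_ball⟩

end Realisation

/-- **`PalasekStep2 R` ⇒ the body of `ForcedClayBlowup`** (every viscosity). [cite: Palasek2026ElementaryModel, §4] -/
theorem forcedClayBlowup_of_palasekStep2 (R : TowerRates) (h : PalasekStep2 R) :
    ∀ ν : ℝ, 0 < ν → ∃ (T : ℝ) (u : ℝ → EuclideanSpace ℝ (Fin 3) → EuclideanSpace ℝ (Fin 3))
      (p : ℝ → EuclideanSpace ℝ (Fin 3) → ℝ)
      (f : ℝ → EuclideanSpace ℝ (Fin 3) → EuclideanSpace ℝ (Fin 3)) (r : ℝ),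
      0 < T ∧ IsClassicalNSSolutionOn (Set.Ico 0 T) ν f u p ∧ HasRapidSpatialDecay (u 0) ∧
        IsSmoothOnHalfSpace f ∧ HasRapidSpaceTimeDecay f ∧
        (∀ T' < T, ∃ C : ℝ≥0∞, C < ⊤ ∧ ∀ t ∈ Set.Icc 0 T', ∫⁻ x, ‖u t x‖ₑ ^ 2 ≤ C) ∧
        (∀ M : ℝ, ∃ t ∈ Set.Ico 0 T, ∃ x : EuclideanSpace ℝ (Fin 3), ‖x‖ ≤ r ∧ M < ‖u t x‖) := by
  intro ν hν
  obtain ⟨W⟩ := h ν hν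
  exact W.forcedClayBlowup_data

/-- **One realisation at one viscosity ⇒ the body of `ForcedClayBlowup` at every viscosity**
(`Realisation.rescale`, Tao 2013 footnote 3). [cite: Palasek2026ElementaryModel, §4] -/
theorem forcedClayBlowup_of_realisation {μ : ℝ} {R : TowerRates} (hμ : 0 < μ) (W : Realisation μ R) :
    ∀ ν : ℝ, 0 < ν → ∃ (T : ℝ) (u : ℝ → EuclideanSpace ℝ (Fin 3) → EuclideanSpace ℝ (Fin 3))
      (p : ℝ → EuclideanSpace ℝ (Fin 3) → ℝ)
      (f : ℝ → EuclideanSpace ℝ (Fin 3) → EuclideanSpace ℝ (Fin 3)) (r : ℝ),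
      0 < T ∧ IsClassicalNSSolutionOn (Set.Ico 0 T) ν f u p ∧ HasRapidSpatialDecay (u 0) ∧
        IsSmoothOnHalfSpace f ∧ HasRapidSpaceTimeDecay f ∧
        (∀ T' < T, ∃ C : ℝ≥0∞, C < ⊤ ∧ ∀ t ∈ Set.Icc 0 T', ∫⁻ x, ‖u t x‖ₑ ^ 2 ≤ C) ∧
        (∀ M : ℝ, ∃ t ∈ Set.Ico 0 T, ∃ x : EuclideanSpace ℝ (Fin 3), ‖x‖ ≤ r ∧ M < ‖u t x‖) :=
  forcedClayBlowup_of_palasekStep2 R (palasekStep2_of_realisation hμ W)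

end Summit.NavierStokesRegularity.FluidComputer.PalasekTowerClayBridge

end
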